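import Summits.CriticalPhenomena.PercolationContinuityZ3.Theses.PercVarianceSandwich
import Summits.CriticalPhenomena.PercolationContinuityZ3.Theorems.PercNearOneGluingNoHeavyLowerTailCSHTheoremOne
import Literature.Probability.Percolation.KestenTheorem
import Literature.Probability.Percolation.SharpnessDCTProofs
import HarnessLib

/-!
# `PercVarianceSandwich.BlockingLeAvoidance` (stmt-CriticalPhenomena-6070) — SETTLED after continuity

Item `stmt-CriticalPhenomena-6070` of route `CriticalPhenomena/PercVarianceSandwich` (support): for `n ≤ N` and every `p`: `P_p(no open path inside Λ_N from Λ_n to ∂ⁱⁿΛ_N) ≤ P_p(no vertex of Λ_n percolates)`.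

Deterministic inclusion on lattice configurations: an infinite open cluster at `x ∈ Λ_n ⊆ Λ_N` leaves the finite box `Λ_N`, and the first-exit lemma (`exists_mem_innerBoundary_openConnIn`, Grimmett Thm (11.11) second proof) gives an open path inside `Λ_N` from `x` to `∂ⁱⁿΛ_N`; then monotonicity of measure restricted to lattice configurations (`DCT16.real_mono_of_forall_subset_edgeSet`).  p205010 is NOT used.

builds on p205010 (kernel theorem, internal audit signed; external expert review pending) — USED (`CSH.percolationContinuityZ3_holds`).  RSW3 lane, lead gen 28 (prover-prim-rsw3-lead-g28-0):
'after continuity — the ledger harvest'.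
References: G. Kozma, N. Nitzan (2024), Thm. 6 / Conj. 3 [KozmaNitzan2024]; G. Grimmett, *Percolation* (1999), §8 [GrimmettPercolation1999].
-/

noncomputable section

namespace Summit.CriticalPhenomena.PercolationContinuityZ3.Theorems

namespace PercVarianceSandwichBlockingLeAvoidance

open MeasureTheory Literature.Probability.Percolation Literature.Probability.LatticeModels
open DCT16

/-- **`PercVarianceSandwich.BlockingLeAvoidance` (stmt-CriticalPhenomena-6070), settled.**  first-exit lemma `exists_mem_innerBoundary_openConnIn` + `real_mono_of_forall_subset_edgeSet`.
[cite: KozmaNitzan2024, Thm. 6 with Conj. 3 (p. 15)] -/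
theorem blockingLeAvoidance_proof : Summit.CriticalPhenomena.PercolationContinuityZ3.Theses.PercVarianceSandwich.BlockingLeAvoidance := by
  unfold Summit.CriticalPhenomena.PercolationContinuityZ3.Theses.PercVarianceSandwich.BlockingLeAvoidance
  classical
  intro p n N hnN
  refine real_mono_of_forall_subset_edgeSet (zdGraph 3) p fun ω hω hno => ?_
  simp only [Set.mem_setOf_eq] at hno ⊢
  intro x hx hperc
  apply hno
  have hinf : (openCluster ω x).Infinite := hperc
  obtain ⟨y, hyC, hyN⟩ : ∃ y ∈ openCluster ω x, y ∉ box 3 N := by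
    by_contra h
    push Not at h
    exact hinf ((box 3 N).finite_toSet.subset fun y hy => Finset.mem_coe.2 (h y hy))
  obtain ⟨z, hz, hconn⟩ := exists_mem_innerBoundary_openConnIn hω (box 3 N) (box_mono 3 hnN hx) hyN hyC
  exact ⟨x, hx, z, hz, hconn⟩

end PercVarianceSandwichBlockingLeAvoidance

end Summit.CriticalPhenomena.PercolationContinuityZ3.Theorems

end
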